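import Mathlib.Data.Sym.Card
import Literature.Barriers.ValiantsHypothesis.CT23ProjCircuitSubstitution
import Literature.Computability.AlgebraicComplexity.UniversalCircuitConstantFree
import HarnessLib

/-!
# Chatterjee–Tengse Lemma 4.7 from the annihilator engine: equations for the evaluation vectors
# of `VP` by constant-free circuits with projection gates (arXiv:2309.07612v2, Lemma 4.7 and its
# proof = v1 Lemma 50; val-lit t18 g8, X-CT23 brick E-g)

Theorem-only companion of `CT23LowerBoundsFromSuccinctHittingSets.lean`; NO definitions, NO named
facts. It proves the tree's named fact `CT23_lemma_4_7` (regime form, see that file) FROM an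
explicit hypothesis `IntEngine` — the integer / constant-free / input-free / multilinear output of
the X-CT23 engine (Thm. 3.1's construction: Lemma 3.2 + Lemma 3.5 + Prop. 2.28, bricks E-a … E-f of
the cell memo `MEMO-t18g7-CT23-engine.md`), stated as a hypothesis binder (not as a named fact):

> `IntEngine`: there is `cE` such that for all `n', m, d, s, w`, every polynomial map
> `G : ℤ^m → ℤ^{n'}` of degree `≤ d` with `(n'd+1)^m < 2^{n'}` (the counting hypothesis of
> `exists_annihilator_degreeOf_lt` at `D = 2`), each of whose coordinates `G_t` is computed (read in
> `ℤ[y ⊕ w]`) by a fan-in-two constant-free projection circuit `Q_t` of size `≤ s` projecting only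
> workspace variables, has a NONZERO MULTILINEAR integer annihilator `A` computed (read in
> `ℤ[x ⊕ u]`) by a fan-in-two constant-free projection circuit of size and workspace
> `≤ ((n'+1)(m+1)(d+1)(s+1))^{cE}`.

and this file supplies the rest of the PRINTED proof of Lemma 4.7 (v1 p0017.txt:L62–L70):
"let `N = binom(n+d, n)` and consider the universal circuit `𝒰(x, y)` … Let `I ⊆ F^n` be an
interpolating set of size `N` … Define a polynomial map `𝒰_{n,d,s} : F^r → F^N` such that each
co-ordinate of `𝒰_{n,d,s}` is exactly `𝒰(x = a, y)` for a unique point `a ∈ I` … `𝒰_{n,d,s}` can be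
encoded by a constant-free circuit of size `poly(n,d,s)` … any annihilator of `𝒰_{n,d,s}` vanishes
on the evaluation vector of every such polynomial … using the proof of Thm. 3.1, we can construct a
multilinear … annihilator … computable by constant-free circuits with projections, of size at most
`(nds)^c`", namely:

* `exists_injective_fin_monomialsDegLE` — `binom(n+d, d)` distinct points of `I_{n,d}` (stars and
  bars: `Sym (Fin (n+1)) d ↪ x^{≤ d}`, Mathlib `Sym.card_sym_eq_choose`); NO bit-decoding of
  `I_{n,d}` is needed, because Lemma 3.5's circuit unrolls the output index (`∏_{a ∈ [n]}`), so the
  `n'` evaluation points are hard-wired, one specialised copy of `𝒰` each;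
* the specialised universal map `G_t(y) = 𝒰(a_t, y) ∈ ℤ[y]` over `ℤ`: degree `≤ 3d + 1`,
  CONSTANT-FREE complexity `≤ τ(𝒰) + d` (`RazUniversal.exists_universalCircuit_int_constantFree`,
  brick E-g0, and `τ(m) ≤ m` for the coordinates `a_{t,i} ≤ d` of the points), as input-free
  projection circuits (`ProjCircuit.ofArithCircuit`, no projection gates at all — which is why
  Lemma 4.7 is untouched by the printed-proof gap B43 of Thm. 3.1 for encoders projecting their
  inputs);
* the transfer "annihilator of `𝒰_{n,d,s}` ⇒ equation for evaluation vectors" through the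
  universality of `𝒰` over the field `F` and the injectivity of `ℤ → F` (characteristic `0`);
* the regime arithmetic: with `T = n+d+s+2`, `n' = (p+1)·T` points (`p ≤ 9376 T²⁶` parameters)
  make the counting hypothesis hold (`2^T > 37508 T²⁸` once `T ≥ 512`), `n' ≤ (nds)^{28} ≤
  (nds)^c ≤ binom(n+d, d)` points are available under the fact's regime hypothesis, and the engine's
  bound is `≤ (nds)^{81 cE}`; the constants of the fact are `c = 81 cE + 28`, `N₀ = 2^{44}`.

Main theorem: **`CT23_lemma_4_7_of_intEngine : IntEngine → CT23_lemma_4_7`**. Once brick E-f lands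
the engine theorem, `CT23_lemma_4_7_holds` is one line. Honest framing: consequences-side
literature (how definable equations for `VP` can be); `VP ≠ VNP` is NOT proved and nothing here
bears on it.

## References

* [ChatterjeeTengse2023] P. Chatterjee, A. Tengse, *Lower Bounds from Succinct Hitting Sets*,
  arXiv:2309.07612v2, Lemma 4.7 and its proof (v1: Lemma 50; held text `paper:arxiv-2309.07612`
  p0017.txt:L58–L70), Prop. 4.4 (v1: Prop. 47), Def. 4.5 (v1: Def. 48).
* [ForbesShpilkaVolk2018] M. A. Forbes, A. Shpilka, B. L. Volk, Theory Comput. 14 (2018), Thm. 12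
  (the universal circuit).
* [Raz2010] R. Raz, Theory Comput. 6 (2010), Prop. 2.8, §3.2.
-/

noncomputable section

open MvPolynomial

namespace Literature.Barriers.ValiantsHypothesis

open Literature.Computability.AlgebraicComplexity

universe u

namespace CT23EvalEq

/-! ### §1. `binom(n+d, d)` hard-wired points of `I_{n,d}` (stars and bars) -/

/-- There are `binom(n+d, d)` monomials of degree `≤ d` in `n` variables, so any `n' ≤ binom(n+d, d)`
indices embed into `x^{≤ d}` = the index set of `I_{n,d}` ("Let `I ⊆ F^n` be an interpolating set
of size `N`"; stars and bars through `Sym (Fin (n+1)) d`: drop the slack letter).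
[cite: ChatterjeeTengse2023, proof of Lemma 4.7 (v1: Lemma 50; p0017.txt:L62–L64)] -/
theorem exists_injective_fin_monomialsDegLE {n d n' : ℕ} (h : n' ≤ (n + d).choose d) :
    ∃ ι : Fin n' → monomialsDegLE n d, Function.Injective ι := by
  classical
  let toF : Sym (Fin (n + 1)) d → (Fin (n + 1) →₀ ℕ) := fun s =>
    Multiset.toFinsupp (s : Multiset (Fin (n + 1)))
  have htoF_inj : Function.Injective toF := fun s₁ s₂ hs => by
    have h' := congrArg Finsupp.toMultiset hs
    simp only [toF, Multiset.toFinsupp_toMultiset] at h'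
    exact Sym.coe_injective h'
  have hdeg : ∀ s, ∑ j : Fin (n + 1), toF s j = d := fun s => by
    have h1 : Multiset.card (Finsupp.toMultiset (toF s)) = d := by
      simp [toF, Multiset.toFinsupp_toMultiset]
    rw [Finsupp.card_toMultiset, Finsupp.sum_fintype _ _ (fun _ => rfl)] at h1
    exact h1
  let ψ : Sym (Fin (n + 1)) d → monomialsDegLE n d := fun s =>
    ⟨Finsupp.equivFunOnFinite.symm (fun i : Fin n => toF s (Fin.castSucc i)), by
      change Finsupp.degree _ ≤ d
      rw [Finsupp.degree_eq_sum, ← hdeg s, Fin.sum_univ_castSucc]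
      simp⟩
  have hψ : Function.Injective ψ := fun s₁ s₂ hs => by
    have hc : ∀ i : Fin n, toF s₁ (Fin.castSucc i) = toF s₂ (Fin.castSucc i) := fun i => by
      have := congrArg (fun m : monomialsDegLE n d => (m : Fin n →₀ ℕ) i) hs
      simpa [ψ] using this
    have hl : toF s₁ (Fin.last n) = toF s₂ (Fin.last n) := by
      have h1 := hdeg s₁
      have h2 := hdeg s₂
      rw [Fin.sum_univ_castSucc] at h1 h2
      have h3 : ∑ i : Fin n, toF s₁ (Fin.castSucc i) = ∑ i : Fin n, toF s₂ (Fin.castSucc i) :=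
        Finset.sum_congr rfl fun i _ => hc i
      omega
    refine htoF_inj (Finsupp.ext fun j => ?_)
    induction j using Fin.lastCases with
    | last => exact hl
    | cast i => exact hc i
  have hcard : Fintype.card (Sym (Fin (n + 1)) d) = (n + d).choose d := by
    rw [Sym.card_sym_eq_choose, Fintype.card_fin]
    congr 1
    omega
  have hn' : n' ≤ Fintype.card (Sym (Fin (n + 1)) d) := hcard ▸ h
  let emb : Fin n' → Sym (Fin (n + 1)) d := fun t => (Fintype.equivFin _).symm (Fin.castLE hn' t)
  have hemb : Function.Injective emb := fun t₁ t₂ ht => by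
    have := (Fintype.equivFin _).symm.injective ht
    exact Fin.castLE_injective hn' this
  exact ⟨ψ ∘ emb, hψ.comp hemb⟩

/-! ### §2. Specialising the universal circuit at a point: degree and constant-free size -/

/-- A substitution by polynomials of degree `≤ 1` does not raise the total degree (twin of the
tree's several private copies). [folklore] -/
private theorem totalDegree_bind₁_le_of_le_one {R : Type*} [CommSemiring R] {σ τ : Type*}
    (θ : σ → MvPolynomial τ R) (hθ : ∀ i, (θ i).totalDegree ≤ 1) (p : MvPolynomial σ R) :
    (MvPolynomial.bind₁ θ p).totalDegree ≤ p.totalDegree := by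
  classical
  conv_lhs => rw [p.as_sum]
  rw [map_sum]
  refine (totalDegree_finsetSum _ _).trans (Finset.sup_le fun d hd => ?_)
  rw [bind₁_monomial]
  refine (totalDegree_mul _ _).trans ?_
  rw [totalDegree_C, zero_add]
  refine (totalDegree_finsetProd _ _).trans ?_
  calc ∑ i ∈ d.support, (θ i ^ d i).totalDegree ≤ ∑ i ∈ d.support, d i :=
        Finset.sum_le_sum fun i _ => (totalDegree_pow _ _).trans
          (by simpa using Nat.mul_le_mul_left (d i) (hθ i))
    _ ≤ p.totalDegree := le_totalDegree hd

/-- **The specialised universal map keeps the degree**: `deg_y 𝒰(a, y) ≤ deg 𝒰` for a point `a`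
of natural numbers substituted for the `x`-variables.
[cite: ChatterjeeTengse2023, proof of Lemma 4.7 (v1: p0017.txt:L64–L66)] -/
theorem totalDegree_specialise_le {n p : ℕ} (U : MvPolynomial (Fin n ⊕ Fin p) ℤ) (a : Fin n → ℕ) :
    (aeval (Sum.elim (fun i => C ((a i : ℕ) : ℤ)) X : Fin n ⊕ Fin p → MvPolynomial (Fin p) ℤ)
        U).totalDegree ≤ U.totalDegree := by
  rw [aeval_eq_bind₁]
  refine totalDegree_bind₁_le_of_le_one _ (fun v => ?_) U
  rcases v with i | j
  · simp only [Sum.elim_inl, totalDegree_C]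
    exact Nat.zero_le _
  · simp only [Sum.elim_inr]
    exact (totalDegree_X (R := ℤ) j).le

/-- **The specialised universal map is constant-free of size `≤ τ(𝒰) + Σ_i a_i`** ("`𝒰_{n,d,s}` can be
encoded by a constant-free circuit of size `poly(n,d,s)`"): plug the numerals `a_i = 1 + ⋯ + 1` into
a constant-free circuit for `𝒰` (`constantFreeComplexity_aeval_le`).
[cite: ChatterjeeTengse2023, proof of Lemma 4.7 (v1: p0017.txt:L64–L66)] -/
theorem constantFreeComplexity_specialise_le {n p : ℕ} (U : MvPolynomial (Fin n ⊕ Fin p) ℤ)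
    (a : Fin n → ℕ) :
    constantFreeComplexity
        (aeval (Sum.elim (fun i => C ((a i : ℕ) : ℤ)) X : Fin n ⊕ Fin p → MvPolynomial (Fin p) ℤ) U) ≤
      constantFreeComplexity U + ∑ i, a i := by
  refine (constantFreeComplexity_aeval_le U _).trans ?_
  rw [Fintype.sum_sum_type]
  have h1 : ∑ i : Fin n, constantFreeComplexity
      ((Sum.elim (fun i => C ((a i : ℕ) : ℤ)) X : Fin n ⊕ Fin p → MvPolynomial (Fin p) ℤ)
        (Sum.inl i)) ≤ ∑ i, a i :=
    Finset.sum_le_sum fun i _ => by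
      simp only [Sum.elim_inl]
      exact RazUniversal.constantFreeComplexity_C_natCast_le (a i)
  have h2 : ∑ j : Fin p, constantFreeComplexity
      ((Sum.elim (fun i => C ((a i : ℕ) : ℤ)) X : Fin n ⊕ Fin p → MvPolynomial (Fin p) ℤ)
        (Sum.inr j)) = 0 :=
    Finset.sum_eq_zero fun j _ => by simp
  omega

/-- Evaluating a substitution: `(P ∘ f)(x) = P(f(x))` (twin of the tree's private copies). [folklore] -/
private theorem eval_bind₁_eq {σ τ R : Type*} [CommSemiring R] (x : τ → R) (f : σ → MvPolynomial τ R)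
    (P : MvPolynomial σ R) : eval x (bind₁ f P) = eval (fun i => eval x (f i)) P := by
  rw [eval, eval₂Hom_bind₁]
  rfl

/-- **Evaluating the universal polynomial at a point of the specialisation**: for constants
`α ∈ F^p`, `𝒰_F(x, α)` at `x = a` is `(𝒰(a, y))_F` at `y = α` — both are `𝒰_F(a, α)`.
[cite: ChatterjeeTengse2023, proof of Lemma 4.7 (v1: p0017.txt:L64–L68)] -/
theorem eval_map_specialise {F : Type u} [CommRing F] {n p : ℕ} (U : MvPolynomial (Fin n ⊕ Fin p) ℤ)
    (a : Fin n → ℕ) (α : Fin p → F) :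
    eval α (MvPolynomial.map (Int.castRingHom F)
        (aeval (Sum.elim (fun i => C ((a i : ℕ) : ℤ)) X : Fin n ⊕ Fin p → MvPolynomial (Fin p) ℤ) U)) =
      eval (Sum.elim (fun i => ((a i : ℕ) : F)) α) (MvPolynomial.map (Int.castRingHom F) U) := by
  rw [aeval_eq_bind₁, map_bind₁, eval_bind₁_eq]
  have hfun : (fun v => eval α (MvPolynomial.map (Int.castRingHom F)
      ((Sum.elim (fun i => C ((a i : ℕ) : ℤ)) X : Fin n ⊕ Fin p → MvPolynomial (Fin p) ℤ) v))) =
      Sum.elim (fun i => ((a i : ℕ) : F)) α := by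
    funext v
    rcases v with i | j
    · simp
    · simp
  rw [hfun]

/-- **The universal polynomial specialised at constants, evaluated at a point**:
`(𝒰_F(x, α))(a) = 𝒰_F(a, α)`. [cite: ChatterjeeTengse2023, proof of Lemma 4.7 (v1: p0017.txt:L66–L68)] -/
theorem eval_aeval_sumElim {F : Type u} [CommRing F] {n p : ℕ} (V : MvPolynomial (Fin n ⊕ Fin p) F)
    (x : Fin n → F) (α : Fin p → F) :
    eval x (aeval (Sum.elim X fun j => C (α j) : Fin n ⊕ Fin p → MvPolynomial (Fin n) F) V) =
      eval (Sum.elim x α) V := by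
  rw [aeval_eq_bind₁, eval_bind₁_eq]
  have hfun : (fun v => eval x ((Sum.elim X fun j => C (α j) : Fin n ⊕ Fin p → MvPolynomial (Fin n) F) v)) =
      Sum.elim x α := by
    funext v
    rcases v with i | j
    · simp
    · simp
  rw [hfun]

/-! ### §3. Arithmetic of the regime -/

/-- `28 k + 44 ≤ 2^k` for `k ≥ 9`. [folklore] -/
private theorem aux_pow_ge (k : ℕ) (hk : 9 ≤ k) : 28 * k + 44 ≤ 2 ^ k := by
  induction k, hk using Nat.le_induction with
  | base => norm_num
  | succ k hk ih => rw [pow_succ]; omega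

/-- **The counting hypothesis is met**: `2^16 · T^28 < 2^T` for `T ≥ 512`. [folklore] -/
private theorem two_pow_gt (T : ℕ) (hT : 512 ≤ T) : 2 ^ 16 * T ^ 28 < 2 ^ T := by
  set k := Nat.log 2 T with hk
  have hk9 : 9 ≤ k := by
    rw [hk]
    exact Nat.le_log_of_pow_le (by norm_num) (by norm_num; omega)
  have hTlt : T < 2 ^ (k + 1) := Nat.lt_pow_succ_log_self (by norm_num) T
  have hTge : 2 ^ k ≤ T := Nat.pow_log_le_self 2 (by omega)
  have h1 : T ^ 28 < (2 ^ (k + 1)) ^ 28 := Nat.pow_lt_pow_left hTlt (by norm_num)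
  have h2 : 28 * k + 44 ≤ T := (aux_pow_ge k hk9).trans hTge
  calc 2 ^ 16 * T ^ 28 < 2 ^ 16 * (2 ^ (k + 1)) ^ 28 := Nat.mul_lt_mul_of_pos_left h1 (by positivity)
    _ = 2 ^ (28 * k + 44) := by rw [← pow_mul, ← pow_add]; congr 1; ring
    _ ≤ 2 ^ T := Nat.pow_le_pow_right (by norm_num) h2

/-- `n + d + s + 2 ≤ n·d·s` once `n, d, s ≥ 2`. [folklore] -/
private theorem add_le_mul_of_two_le {n d s : ℕ} (hn : 2 ≤ n) (hd : 2 ≤ d) (hs : 2 ≤ s) :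
    n + d + s + 2 ≤ n * d * s := by
  have h1 : 4 * n ≤ n * d * s := by
    have : 4 ≤ d * s := by nlinarith
    calc 4 * n = n * 4 := by ring
      _ ≤ n * (d * s) := Nat.mul_le_mul_left n this
      _ = n * d * s := by ring
  have h2 : 4 * d ≤ n * d * s := by
    have : 4 ≤ n * s := by nlinarith
    calc 4 * d = d * 4 := by ring
      _ ≤ d * (n * s) := Nat.mul_le_mul_left d this
      _ = n * d * s := by ring
  have h3 : 4 * s ≤ n * d * s := by
    have : 4 ≤ n * d := by nlinarith
    calc 4 * s = s * 4 := by ring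
      _ ≤ s * (n * d) := Nat.mul_le_mul_left s this
      _ = n * d * s := by ring
  omega

/-- `(p+2)`, `(n'+1)`, … : the engine's polynomial bound is `≤ T^81` for `T` beyond the constant
`9378² · 4 · 21878`. [folklore] -/
private theorem engine_bound_le {T p d : ℕ} (hp : p ≤ 9376 * T ^ 26) (hdT : d + 2 ≤ T)
    (hT : 9378 * 9378 * 4 * 21878 ≤ T) :
    ((p + 1) * T + 1) * (p + 1 + 1) * (3 * d + 1 + 1) * (21877 * T ^ 26 + d + 1) ≤ T ^ 81 := by
  have h1T : 1 ≤ T := by omega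
  have hT26 : 1 ≤ T ^ 26 := Nat.one_le_pow _ _ h1T
  have hT27 : T ≤ T ^ 26 := Nat.le_self_pow (by norm_num) T
  have hT27' : 1 ≤ T ^ 27 := Nat.one_le_pow _ _ h1T
  have ha : (p + 1) * T + 1 ≤ 9378 * T ^ 27 := by
    calc (p + 1) * T + 1 ≤ (9376 * T ^ 26 + T ^ 26) * T + T ^ 27 := by gcongr
      _ = 9378 * T ^ 27 := by ring
  have hb : p + 1 + 1 ≤ 9378 * T ^ 26 := by
    calc p + 1 + 1 ≤ 9376 * T ^ 26 + T ^ 26 + T ^ 26 := by gcongr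
      _ = 9378 * T ^ 26 := by ring
  have hc : 3 * d + 1 + 1 ≤ 4 * T := by omega
  have hd : 21877 * T ^ 26 + d + 1 ≤ 21878 * T ^ 26 := by
    have : d + 1 ≤ T ^ 26 := by
      calc d + 1 ≤ T := by omega
        _ ≤ T ^ 26 := hT27
    omega
  calc ((p + 1) * T + 1) * (p + 1 + 1) * (3 * d + 1 + 1) * (21877 * T ^ 26 + d + 1)
      ≤ (9378 * T ^ 27) * (9378 * T ^ 26) * (4 * T) * (21878 * T ^ 26) :=
        Nat.mul_le_mul (Nat.mul_le_mul (Nat.mul_le_mul ha hb) hc) hd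
    _ = (9378 * 9378 * 4 * 21878) * T ^ 80 := by ring
    _ ≤ T * T ^ 80 := Nat.mul_le_mul_right _ hT
    _ = T ^ 81 := by ring

/-- The number of hard-wired points `n' = (p+1)·T` is `≤ T^28`. [folklore] -/
private theorem points_le {T p : ℕ} (hp : p ≤ 9376 * T ^ 26) (hT : 9377 ≤ T) : (p + 1) * T ≤ T ^ 28 := by
  have h1T : 1 ≤ T := by omega
  have hT26 : 1 ≤ T ^ 26 := Nat.one_le_pow _ _ h1T
  calc (p + 1) * T ≤ (9376 * T ^ 26 + T ^ 26) * T := by gcongr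
    _ = 9377 * T ^ 27 := by ring
    _ ≤ T * T ^ 27 := Nat.mul_le_mul_right _ hT
    _ = T ^ 28 := by ring

/-- The counting hypothesis `(n'd' + 1)^{m'} < 2^{n'}` for `n' = m'·T`, `m' = p + 1`, `d' = 3d + 1`.
[cite: ChatterjeeTengse2023, proof of Lemma 4.7 "that the annihilator can be multilinear is guaranteed by the bound on the individual degree from Lemma 3.2" (v1: p0017.txt:L69–L70)] -/
theorem count_lt {T p d : ℕ} (hp : p ≤ 9376 * T ^ 26) (hdT : d + 2 ≤ T) (hT : 512 ≤ T) :
    ((p + 1) * T * (3 * d + 1) + 1) ^ (p + 1) < 2 ^ ((p + 1) * T) := by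
  have h1T : 1 ≤ T := by omega
  have hT26 : 1 ≤ T ^ 26 := Nat.one_le_pow _ _ h1T
  have hT28 : 1 ≤ T ^ 28 := Nat.one_le_pow _ _ h1T
  have hbase : (p + 1) * T * (3 * d + 1) + 1 < 2 ^ T := by
    calc (p + 1) * T * (3 * d + 1) + 1 ≤ (9376 * T ^ 26 + T ^ 26) * T * (3 * T) + T ^ 28 := by
          gcongr
          omega
      _ = 28132 * T ^ 28 := by ring
      _ ≤ 2 ^ 16 * T ^ 28 := by gcongr; norm_num
      _ < 2 ^ T := two_pow_gt T hT
  calc ((p + 1) * T * (3 * d + 1) + 1) ^ (p + 1) < (2 ^ T) ^ (p + 1) :=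
        Nat.pow_lt_pow_left hbase (by omega)
    _ = 2 ^ ((p + 1) * T) := by rw [← pow_mul, mul_comm]

end CT23EvalEq

open CT23EvalEq in
/-- **CT23 Lemma 4.7 from the annihilator engine.** The tree's named fact `CT23_lemma_4_7`
(Chatterjee–Tengse Lemma 4.7, regime form: "There exists a constant `c`, such that for all large
enough `n, d, s ∈ ℕ`" with `(nds)^c ≤ binom(n+d, d)`, "a multilinear equation for the evaluation
vectors of the set of `n`-variate, degree-`d` polynomials computable by circuits of size `s`, is
computable by constant-free circuits with projection gates of size at most `(nds)^c`") FOLLOWS from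
the integer / constant-free / input-free / multilinear annihilator engine `IntEngine` (the
hypothesis `hE`, = the output of the X-CT23 engine bricks E-a … E-f for Thm. 3.1's construction at
`D = 2`), by the printed proof: hard-wire `n' = (p+1)(n+d+s+2)` points `a_t` of the interpolating
set `I_{n,d}` (`exists_injective_fin_monomialsDegLE`; available because `n' ≤ (nds)^{28} ≤ (nds)^c ≤
binom(n+d, d)`), specialise the CONSTANT-FREE integer universal circuit `𝒰` at them
(`RazUniversal.exists_universalCircuit_int_constantFree`; `G_t(y) = 𝒰(a_t, y) ∈ ℤ[y]`, degree
`≤ 3d+1`, `τ ≤ τ(𝒰) + d`, projection-free circuits `ProjCircuit.ofArithCircuit`), take the engine's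
nonzero multilinear integer annihilator `A` of `(G_t)_t` (the counting hypothesis
`(n'(3d+1)+1)^{p+1} < 2^{n'}` holds since `2^T > 2^{16} T^{28}` for `T ≥ 512`), rename its variables
into `x^{≤ d}`, and check that it vanishes at the evaluation vector of every `f ∈ F[x_1..x_n]` of
degree `≤ d` and complexity `≤ s` because `f = 𝒰_F(x, α)` for some `α ∈ F^p` (universality over `F`)
so that `f(a_t) = (G_t)_F(α)` and `A_F(f(a_•)) = (A ∘ G)_F(α) = 0`. Constants: `c = 81 cE + 28`,
`N₀ = 2^{44}`. Once the engine theorem lands (brick E-f), `CT23_lemma_4_7_holds` is one line.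
[cite: ChatterjeeTengse2023, Lemma 4.7 and its proof (v1: Lemma 50; p0017.txt:L58–L70)] -/
theorem CT23_lemma_4_7_of_intEngine
    (hE : ∃ cE : ℕ, ∀ (n' m d s w : ℕ) (G : Fin n' → MvPolynomial (Fin m) ℤ)
        (Q : Fin n' → ProjCircuit ℤ (Fin m ⊕ Fin w)),
        2 ≤ n' → 1 ≤ m → 1 ≤ d → 1 ≤ s → (∀ t, (G t).totalDegree ≤ d) →
        (n' * d + 1) ^ m < 2 ^ n' →
        (∀ t, (Q t).IsFanInTwo ∧ (Q t).HasSignConstants ∧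
          (Q t).Computes (rename Sum.inl (G t)) ∧ (Q t).size ≤ s ∧
          (Q t).projVars ⊆ Set.range Sum.inr) →
        ∃ (u : ℕ) (A : MvPolynomial (Fin n') ℤ) (Q' : ProjCircuit ℤ (Fin n' ⊕ Fin u)),
          A ≠ 0 ∧ (∀ j, A.degreeOf j ≤ 1) ∧ aeval G A = 0 ∧ Q'.IsFanInTwo ∧
            Q'.HasSignConstants ∧ Q'.Computes (rename Sum.inl A) ∧
            u ≤ ((n' + 1) * (m + 1) * (d + 1) * (s + 1)) ^ cE ∧
            Q'.size ≤ ((n' + 1) * (m + 1) * (d + 1) * (s + 1)) ^ cE) :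
    CT23_lemma_4_7 := by
  obtain ⟨cE, hE⟩ := hE
  intro F _ _
  refine ⟨81 * cE + 28, 2 ^ 44, fun n d s hn hd hs hreg => ?_⟩
  -- the CONSTANT-FREE universal circuit over `ℤ`
  obtain ⟨p, U, hp, hτU, -, hUdeg, hUniv⟩ :=
    RazUniversal.exists_universalCircuit_int_constantFree.{0} n s d
  -- parameters
  have hT512 : 512 ≤ n + d + s + 2 := by omega
  have hT9377 : 9377 ≤ n + d + s + 2 := by omega
  have hTbig : 9378 * 9378 * 4 * 21878 ≤ n + d + s + 2 := by norm_num; omega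
  have hdT : d + 2 ≤ n + d + s + 2 := by omega
  have hTM : n + d + s + 2 ≤ n * d * s :=
    add_le_mul_of_two_le (by omega) (by omega) (by omega)
  have hMpos : 1 ≤ n * d * s := by omega
  -- the points: `n' = (p+1)·T ≤ (nds)^{28} ≤ (nds)^c ≤ binom(n+d, d)`
  have hn'c : (p + 1) * (n + d + s + 2) ≤ (n * d * s) ^ (81 * cE + 28) :=
    calc (p + 1) * (n + d + s + 2) ≤ (n + d + s + 2) ^ 28 := points_le hp hT9377
      _ ≤ (n * d * s) ^ 28 := Nat.pow_le_pow_left hTM 28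
      _ ≤ (n * d * s) ^ (81 * cE + 28) := Nat.pow_le_pow_right hMpos (by omega)
  obtain ⟨ι, hι⟩ := exists_injective_fin_monomialsDegLE (n := n) (d := d) (hn'c.trans hreg)
  -- the points' coordinates `a_t ∈ I_{n,d}`
  have ha : ∀ t : Fin ((p + 1) * (n + d + s + 2)),
      ∑ i, ((ι t : monomialsDegLE n d) : Fin n →₀ ℕ) i ≤ d := fun t => by
    have h := (ι t).2
    change Finsupp.degree _ ≤ d at h
    rwa [Finsupp.degree_eq_sum] at h
  -- the specialised universal map `G_t(y) = 𝒰(a_t, y)`, padded by one idle parameter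
  set G : Fin ((p + 1) * (n + d + s + 2)) → MvPolynomial (Fin (p + 1)) ℤ := fun t =>
    rename Fin.castSucc
      (aeval (Sum.elim (fun i => C ((((ι t : monomialsDegLE n d) : Fin n →₀ ℕ) i : ℕ) : ℤ)) X :
        Fin n ⊕ Fin p → MvPolynomial (Fin p) ℤ) U) with hGdef
  have hGdeg : ∀ t, (G t).totalDegree ≤ 3 * d + 1 := fun t =>
    (totalDegree_rename_le _ _).trans ((totalDegree_specialise_le U _).trans hUdeg)
  -- its circuits: constant-free, projection-free, size `≤ τ(𝒰) + d`
  have hGτ : ∀ t, constantFreeComplexity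
      (rename (Sum.inl : Fin (p + 1) → Fin (p + 1) ⊕ Fin 0) (G t)) ≤
        21877 * (n + d + s + 2) ^ 26 + d := fun t =>
    calc constantFreeComplexity (rename (Sum.inl : Fin (p + 1) → Fin (p + 1) ⊕ Fin 0) (G t))
        ≤ constantFreeComplexity (G t) := constantFreeComplexity_rename_le _ _
      _ ≤ constantFreeComplexity (aeval (Sum.elim
            (fun i => C ((((ι t : monomialsDegLE n d) : Fin n →₀ ℕ) i : ℕ) : ℤ)) X :
              Fin n ⊕ Fin p → MvPolynomial (Fin p) ℤ) U) := constantFreeComplexity_rename_le _ _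
      _ ≤ constantFreeComplexity U + ∑ i, (((ι t : monomialsDegLE n d) : Fin n →₀ ℕ) i : ℕ) :=
          constantFreeComplexity_specialise_le U _
      _ ≤ 21877 * (n + d + s + 2) ^ 26 + d := Nat.add_le_add hτU (ha t)
  have hQex : ∀ t, ∃ Qt : ProjCircuit ℤ (Fin (p + 1) ⊕ Fin 0), Qt.IsFanInTwo ∧ Qt.HasSignConstants ∧
      Qt.Computes (rename Sum.inl (G t)) ∧ Qt.size ≤ 21877 * (n + d + s + 2) ^ 26 + d ∧
      Qt.projVars ⊆ Set.range Sum.inr := fun t => by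
    obtain ⟨C0, h1, h2, h3, h4⟩ :=
      ArithCircuit.exists_computes_size_eq_constantFreeComplexity (rename Sum.inl (G t))
    refine ⟨ProjCircuit.ofArithCircuit C0, ProjCircuit.isFanInTwo_ofArithCircuit h1,
      ProjCircuit.hasSignConstants_ofArithCircuit h2, ?_, ?_, ?_⟩
    · change (ProjCircuit.ofArithCircuit C0).eval = _
      rw [ProjCircuit.eval_ofArithCircuit]
      exact h3
    · rw [ProjCircuit.size_ofArithCircuit, h4]
      exact hGτ t
    · rintro v ⟨b, w, hg⟩
      simp [ProjCircuit.ofArithCircuit] at hg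
  choose Q hQ using hQex
  -- the engine: a nonzero MULTILINEAR integer annihilator with a small constant-free circuit
  obtain ⟨u, A, Q', hA0, hAml, hAG, hQ'2, hQ'sc, hQ'comp, hu, hQ'size⟩ :=
    hE ((p + 1) * (n + d + s + 2)) (p + 1) (3 * d + 1) (21877 * (n + d + s + 2) ^ 26 + d) 0 G Q
      ((show 2 ≤ n + d + s + 2 by omega).trans (Nat.le_mul_of_pos_left _ (by omega)))
      (by omega) (by omega) (le_add_left (by omega))
      hGdeg (count_lt hp hdT hT512) hQ
  have hbound : (((p + 1) * (n + d + s + 2) + 1) * (p + 1 + 1) * (3 * d + 1 + 1) *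
      (21877 * (n + d + s + 2) ^ 26 + d + 1)) ^ cE ≤ (n * d * s) ^ (81 * cE + 28) :=
    calc (((p + 1) * (n + d + s + 2) + 1) * (p + 1 + 1) * (3 * d + 1 + 1) *
          (21877 * (n + d + s + 2) ^ 26 + d + 1)) ^ cE
        ≤ ((n + d + s + 2) ^ 81) ^ cE := Nat.pow_le_pow_left (engine_bound_le hp hdT hTbig) cE
      _ ≤ ((n * d * s) ^ 81) ^ cE := Nat.pow_le_pow_left (Nat.pow_le_pow_left hTM 81) cE
      _ = (n * d * s) ^ (81 * cE) := by rw [← pow_mul]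
      _ ≤ (n * d * s) ^ (81 * cE + 28) := Nat.pow_le_pow_right hMpos (by omega)
  -- transport to the variables `x^{≤ d}`
  let e : Fin ((p + 1) * (n + d + s + 2)) ⊕ Fin u → monomialsDegLE n d ⊕ Fin u := Sum.map ι id
  have he : Function.Injective e := Sum.map_injective.2 ⟨hι, fun _ _ h => h⟩
  have hρ : ∀ i ws, (ArithCircuit.Operand.var (e i) : ArithCircuit.Operand ℤ _).eval
      (ProjCircuit.gateValues ([] : List (ProjCircuit.Gate ℤ (monomialsDegLE n d ⊕ Fin u))) ++ ws) =
        X (e i) := fun i ws => rfl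
  have hcompat : Q'.SubstCompat e (fun v => X (e v)) :=
    ProjCircuit.substCompat_of_vars Q' (fun i _ => rfl) (fun i _ i' hne => by
      rw [vars_X, Finset.mem_singleton]
      exact fun h => hne (he h).symm)
  refine ⟨u, rename ι A, Q'.subst [] e (fun v => ArithCircuit.Operand.var (e v)),
    ?_, ?_, ?_, ?_, ?_, hu.trans hbound, ?_, ?_⟩
  · -- nonzero
    exact fun h => hA0 (rename_injective ι hι (by rw [h, map_zero]))
  · -- multilinear
    intro v
    classical
    by_cases hv : v ∈ Set.range ι
    · obtain ⟨t, rfl⟩ := hv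
      rw [degreeOf_rename_of_injective hι]
      exact hAml t
    · rw [degreeOf_eq_sup, support_rename_of_injective hι]
      refine Finset.sup_le fun m hm => ?_
      obtain ⟨m', -, rfl⟩ := Finset.mem_image.mp hm
      rw [Finsupp.mapDomain_notin_range _ _ hv]
      exact Nat.zero_le _
  · -- fan-in two
    exact ProjCircuit.isFanInTwo_subst hQ'2 (by simp) e _
  · -- constant-free
    exact ProjCircuit.hasSignConstants_subst hQ'sc (by simp) e
      (fun i => ArithCircuit.Operand.hasSignConstants_var _)
  · -- computes `rename inl (rename ι A)`
    have hQ'eval : Q'.eval = rename Sum.inl A := hQ'comp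
    have hre : ∀ q : MvPolynomial (Fin ((p + 1) * (n + d + s + 2)) ⊕ Fin u) ℤ,
        aeval (fun v => X (e v)) q = rename e q := fun q =>
      DFunLike.congr_fun (MvPolynomial.algHom_ext (fun v => by simp [rename_X])) q
    have hcomp : e ∘ Sum.inl = Sum.inl ∘ ι := funext fun x => rfl
    change (Q'.subst [] e _).eval = _
    rw [ProjCircuit.eval_subst Q' [] hρ hcompat, hQ'eval, hre, rename_rename, rename_rename, hcomp]
  · -- size
    rw [ProjCircuit.size_subst, List.length_nil, zero_add]
    exact hQ'size.trans hbound
  · -- vanishing at the evaluation vector of every small `f`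
    intro f hfd hfs
    obtain ⟨α, hα⟩ := hUniv F f hfd hfs
    have hpt : ∀ t, evalVector F d f (ι t) =
        eval (Fin.snoc α 0 : Fin (p + 1) → F) (MvPolynomial.map (Int.castRingHom F) (G t)) := by
      intro t
      rw [evalVector_apply, ← hα, eval_aeval_sumElim, hGdef]
      simp only [map_rename, eval_rename]
      have hsnoc : ((Fin.snoc α 0 : Fin (p + 1) → F) ∘ Fin.castSucc) = α :=
        funext fun j => Fin.snoc_castSucc (α := fun _ => F) _ _ j
      rw [hsnoc, eval_map_specialise]
      rfl
    rw [map_rename, eval_rename]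
    have hfun : (evalVector F d f ∘ ι) =
        fun t => eval (Fin.snoc α 0 : Fin (p + 1) → F) (MvPolynomial.map (Int.castRingHom F) (G t)) :=
      funext hpt
    rw [hfun]
    have h := congrArg
      (fun q => eval (Fin.snoc α 0 : Fin (p + 1) → F) (MvPolynomial.map (Int.castRingHom F) q)) hAG
    simp only [map_zero, aeval_eq_bind₁, map_bind₁, eval_bind₁_eq] at h
    exact h

end Literature.Barriers.ValiantsHypothesis

end
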